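import Mathlib
import HarnessLib
import Literature.MathematicalPhysics.StatisticalMechanics.InitialActivitySecondDiff
import Literature.MathematicalPhysics.StatisticalMechanics.StrongNormExpSecondDiffPolymer

/-!
# [ABKM19] Lemma 12.2 at second order, difference form: JOINT mixed second differences of the initial
# activity `K̂_0(𝒦, ℋ) = e^{−ℋ}∏𝒦` in (perturbation, relevant seed) on a polymer

Continuation of `InitialActivityPerturbationLipschitz.lean`, `InitialActivitySecondDiff.lean`,
`StrongNormExpSecondDiffPolymer.lean`.  Over a joint parallelogram `(𝒦 + iU + jV, ℋ + iY + jZ)`,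
`i, j ∈ {0,1}`, the discrete Leibniz rule
`Σ± f_{ij}g_{ij} = (Σ±f)·g₁₁ + (f₁₀ − f₀₀)(g₁₁ − g₁₀) + (f₀₁ − f₀₀)(g₁₁ − g₀₁) + f₀₀·(Σ±g)`
(`f_{ij} = e^{−(ℋ+iY+jZ)(X)}`, `g_{ij} = ∏_{x∈X}(𝒦+iU+jV)(∇φ(x))`) and the four landed estimates — value,
first and second differences of the Boltzmann factor on a polymer (Lemma 9.3 and its difference forms)
and of the site product (Lemma 12.3 and its difference forms) — give

* **`tayNormLE_initKH_jointSecondDiff`** — the `T_φ`-norm bound of `Σ± K̂_0(𝒦_{ij}, ℋ_{ij})(X)` with the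
  scale-`0` weight `w_0^X` of the torus data, constant = the corresponding combination of the numerical
  value/difference constants (every term carries a factor `∝ ‖Y‖·v`, `‖Z‖·u`, `‖Y‖‖Z‖` or `uv` for
  bounded `|X|`).

This is the polymer-level content of the hypothesis `hμ12` (joint parallelogram second differences of
`y₀^{ij}(h) = K̂_0(𝒦 + iU + jV, h)`) of the second-order fixed-point theorem
`RGFlow.secondDiff_initial_le_of_isTunedQ`; the remaining passage to the weak norm `‖·‖_0^{(A)}` is the
absorption of `A^{|X|}` by the small factors `((ρ+u+v)e^{𝔥_0})^{|X|}` (as in `weakNormLE_initKH`).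
Everything is proved; no named fact.

## References
* S. Adams, S. Buchholz, R. Kotecký, S. Müller, arXiv:1910.13564, Lemma 12.2 (12.9) (`j₁ + j₂ = 2`),
  Lemma 12.3, Lemma 9.3 [AdamsBuchholzKoteckyMuller2019].
-/

noncomputable section

namespace Literature.MathematicalPhysics.StatisticalMechanics.GradientRG

open scoped BigOperators Classical
open Finset Matrix
open Literature.MathematicalPhysics.StatisticalMechanics.TorusPolymer
  (IsPolymer blocks bprod blockOf thicken numBlocks mem_blocks subset_thicken thicken_mono
    isPolymer_empty card_blocks_eq_numBlocks)
open Literature.MathematicalPhysics.QuantumFieldTheory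

variable {d M : ℕ} [NeZero M]

omit [NeZero M] in
/-- Weighted derivative bounds add. [cite: AdamsBuchholzKoteckyMuller2019, Ch. 2.1 (the norm on E)] -/
theorem iteratedFDeriv_bound_add {r₀ : ℕ} {a b : ℝ} {f g : (Fin d → ℝ) → ℂ} (hf : ContDiff ℝ r₀ f)
    (hg : ContDiff ℝ r₀ g)
    (hfb : ∀ k, k ≤ r₀ → ∀ z : Fin d → ℝ, ‖iteratedFDeriv ℝ k f z‖ ≤ a * Real.exp ((∑ i, z i ^ 2) / 4))
    (hgb : ∀ k, k ≤ r₀ → ∀ z : Fin d → ℝ, ‖iteratedFDeriv ℝ k g z‖ ≤ b * Real.exp ((∑ i, z i ^ 2) / 4)) :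
    ∀ k, k ≤ r₀ → ∀ z : Fin d → ℝ,
      ‖iteratedFDeriv ℝ k (fun z => f z + g z) z‖ ≤ (a + b) * Real.exp ((∑ i, z i ^ 2) / 4) := by
  intro k hk z
  have e : (fun z => f z + g z) = f + g := rfl
  have hk' : (k : WithTop ℕ∞) ≤ r₀ := by exact_mod_cast hk
  rw [e, iteratedFDeriv_add_apply ((hf.of_le hk').contDiffAt) ((hg.of_le hk').contDiffAt), add_mul]
  exact (norm_add_le _ _).trans (add_le_add (hfb k hk z) (hgb k hk z))

/-- **Joint mixed second differences of `K̂_0(𝒦, ℋ)(X)` on a polymer** ([ABKM19] Lemma 12.2 with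
`j₁ + j₂ = 2`, difference form, torus data at scale `0`). [cite: AdamsBuchholzKoteckyMuller2019, Lemma 12.2 (12.9)] -/
theorem tayNormLE_initKH_jointSecondDiff {L N Mord R n p r₀ : ℕ} {θbar lam μ δ₁ δ₀ A𝒫 h A : ℝ}
    {𝒞 : ℕ → (Fin d → ZMod M) → ℝ} (hd : 2 ≤ d) (hLodd : Odd L) (hM : M = L ^ N)
    (hp : d / 2 + 1 ≤ p) (hMord : d / 2 + 1 ≤ Mord)
    (hB : AbkmWeightBounds L N Mord R n θbar lam μ δ₁ δ₀ A𝒫 𝒞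
      (abkmWeightData L N Mord R θbar (schedDelta δ₀ δ₁ N) 𝒞))
    (hδ₀ : 0 < δ₀) (hδ₁ : 0 < δ₁) (hh : 0 < h) (hh0 : hZeroSq d R δ₀ δ₁ ≤ h ^ 2)
    {𝒦 U V : (Fin d → ℝ) → ℂ} {ρ u v : ℝ}
    (h𝒦 : ContDiff ℝ r₀ 𝒦) (hU : ContDiff ℝ r₀ U) (hV : ContDiff ℝ r₀ V)
    (h𝒦b : ∀ k, k ≤ r₀ → ∀ z : Fin d → ℝ, ‖iteratedFDeriv ℝ k 𝒦 z‖ ≤ ρ * Real.exp ((∑ i, z i ^ 2) / 4))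
    (hUb : ∀ k, k ≤ r₀ → ∀ z : Fin d → ℝ, ‖iteratedFDeriv ℝ k U z‖ ≤ u * Real.exp ((∑ i, z i ^ 2) / 4))
    (hVb : ∀ k, k ≤ r₀ → ∀ z : Fin d → ℝ, ‖iteratedFDeriv ℝ k V z‖ ≤ v * Real.exp ((∑ i, z i ^ 2) / 4))
    {H Y Z : RelevantHamiltonian ℂ d}
    (hH : hamNorm (fieldWt h (L : ℝ) d 0) ((L : ℝ) ^ 0) (L ^ (d * 0)) H ≤ 1 / 16)
    (hHY : hamNorm (fieldWt h (L : ℝ) d 0) ((L : ℝ) ^ 0) (L ^ (d * 0)) (H + Y) ≤ 1 / 16)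
    (hHZ : hamNorm (fieldWt h (L : ℝ) d 0) ((L : ℝ) ^ 0) (L ^ (d * 0)) (H + Z) ≤ 1 / 16)
    (hHYZ : hamNorm (fieldWt h (L : ℝ) d 0) ((L : ℝ) ^ 0) (L ^ (d * 0)) (H + Y + Z) ≤ 1 / 16)
    (hY : hamNorm (fieldWt h (L : ℝ) d 0) ((L : ℝ) ^ 0) (L ^ (d * 0)) Y ≤ 1 / 32)
    (hZ : hamNorm (fieldWt h (L : ℝ) d 0) ((L : ℝ) ^ 0) (L ^ (d * 0)) Z ≤ 1 / 32)
    (X : Finset (Fin d → ZMod M)) :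
    let nY := hamNorm (fieldWt h (L : ℝ) d 0) ((L : ℝ) ^ 0) (L ^ (d * 0)) Y
    let nZ := hamNorm (fieldWt h (L : ℝ) d 0) ((L : ℝ) ^ 0) (L ^ (d * 0)) Z
    let e' := Real.exp (fieldWt h (L : ℝ) d 0 / (L : ℝ) ^ 0)
    let a := Real.exp (1 / 4)
    let α := 16 * Real.exp (3 / 8) * nY
    let β := 16 * Real.exp (3 / 8) * nZ
    let γ := 256 * Real.exp (1 / 4) * nY * nZ
    let m := X.card
    TayNormLE ((abkmNormParams L N Mord R p r₀ h θbar A (schedDelta δ₀ δ₁ N) 𝒞).gauge 0 X) r₀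
      ((abkmWeightData L N Mord R θbar (schedDelta δ₀ δ₁ N) 𝒞).weight 0 X)
      (fun φ => initKH (fun z => 𝒦 z + U z + V z) (H + Y + Z) X φ - initKH (fun z => 𝒦 z + U z) (H + Y) X φ
        - initKH (fun z => 𝒦 z + V z) (H + Z) X φ + initKH 𝒦 H X φ)
      ((((a + α + β) ^ m - (a + α) ^ m - ((a + β) ^ m - a ^ m)) + ((a + γ) ^ m - a ^ m)) * ((ρ + u + v) * e') ^ m
        + ((a + α) ^ m - a ^ m) * (((ρ + u + v) * e') ^ m - ((ρ + u) * e') ^ m)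
        + ((a + β) ^ m - a ^ m) * (((ρ + u + v) * e') ^ m - ((ρ + v) * e') ^ m)
        + a ^ m * ((((ρ + u + v) * e') ^ m - ((ρ + u) * e') ^ m) - (((ρ + v) * e') ^ m - (ρ * e') ^ m))) := by
  intro nY nZ e' a α β γ m
  set P := abkmNormParams L N Mord R p r₀ h θbar A (schedDelta δ₀ δ₁ N) 𝒞 with hP
  set W := abkmWeightData L N Mord R θbar (schedDelta δ₀ δ₁ N) 𝒞 with hW
  have hL0 : (0 : ℝ) < L := by exact_mod_cast hLodd.pos
  have h𝔥 : 0 < fieldWt h (L : ℝ) d 0 := fieldWt_pos hh hL0 d 0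
  have hR0 : (0 : ℝ) < (L : ℝ) ^ 0 := by positivity
  have hp1 : 1 ≤ p := le_trans (by omega) hp
  have nonneg_of : ∀ {F : (Fin d → ℝ) → ℂ} {t : ℝ},
      (∀ k, k ≤ r₀ → ∀ z : Fin d → ℝ, ‖iteratedFDeriv ℝ k F z‖ ≤ t * Real.exp ((∑ i, z i ^ 2) / 4)) → 0 ≤ t :=
    fun hb => by
      have h0 := (norm_nonneg _).trans (hb 0 (Nat.zero_le _) 0)
      exact (mul_nonneg_iff_of_pos_right (Real.exp_pos _)).1 h0
  have hρ : 0 ≤ ρ := nonneg_of h𝒦b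
  have hu : 0 ≤ u := nonneg_of hUb
  have hv : 0 ≤ v := nonneg_of hVb
  have he'0 : 0 ≤ e' := (Real.exp_pos _).le
  have hnY0 : 0 ≤ nY := hamNorm_nonneg h𝔥.le hR0.le _ _
  have hnZ0 : 0 ≤ nZ := hamNorm_nonneg h𝔥.le hR0.le _ _
  have ha0 : 0 ≤ a := (Real.exp_pos _).le
  have hα0 : 0 ≤ α := by positivity
  have hβ0 : 0 ≤ β := by positivity
  have hγ0 : 0 ≤ γ := by positivity
  have hMt : M = L ^ 0 * L ^ N := by rw [pow_zero, one_mul]; exact hM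
  have hsodd : Odd (L ^ 0) := hLodd.pow
  have htodd : Odd (L ^ N) := hLodd.pow
  -- strong family
  set G : ℕ → Finset (Fin d → ZMod M) → Matrix (Fin d → ZMod M) (Fin d → ZMod M) ℝ :=
    fun j Y' => strongCoef h N j • derivForm (L : ℝ) j (diffIndex d Mord)
      (boxDensity (boxRad R L j) (boxWt (L : ℝ) d j) Y') with hG
  have hGs : W.StrongDominated G fun _ X Y => Disjoint X Y :=
    hB.strong (diffIndex d Mord) (fun α hα => hα) (strongCoef h N) (strongCoef_le hδ₀ hδ₁ hh hh0)
  have hX' : IsPolymer (L ^ 0) X := by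
    rw [pow_zero]; exact isPolymer_one X
  have hcard : ∀ x : Fin d → ZMod M, (blockOf (L ^ 0) x).card = L ^ (d * 0) := fun x => by
    rw [TorusPolymer.card_blockOf hMt hsodd htodd x, ← pow_mul, mul_comm]
  have hleb : ∀ B ∈ blocks (L ^ 0) X, ∀ ξ, ‖P.gauge 0 B ξ‖ ≤ ‖P.gauge 0 X ξ‖ := fun B hBm ξ =>
    norm_fieldGauge_mono_set _ _ _ (thicken_mono _ (hX'.subset_of_mem_blocks hBm)) ξ
  have hmX : numBlocks (L ^ 0) X = m := numBlocks_pow_zero L X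
  -- the Boltzmann factors: value, first differences, second difference
  have hEd : ∀ (H₀ : RelevantHamiltonian ℂ d) (B : Finset (Fin d → ZMod M)), ContDiff ℝ r₀ (expNegH H₀ B) :=
    fun H₀ B => (contDiff_eval H₀ B (n := r₀)).neg.cexp
  have hEloc : ∀ (H₀ : RelevantHamiltonian ℂ d) (B : Finset (Fin d → ZMod M)), B ⊆ X →
      IsGaugeLocal (P.gauge 0 X) (expNegH H₀ B) := fun H₀ B hBX =>
    isGaugeLocal_cexp_neg_eval h𝔥.ne' hR0.ne' hp ((hBX).trans (subset_thicken _ _)) H₀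
  have hval : ∀ (H₀ : RelevantHamiltonian ℂ d), hamNorm (fieldWt h (L : ℝ) d 0) ((L : ℝ) ^ 0) (L ^ (d * 0)) H₀ ≤ 1 / 8 →
      TayNormLE (P.gauge 0 X) r₀ (expWeight (G 0 X)) (expNegH H₀ X) (a ^ m) := by
    intro H₀ hH₀
    have hF : ∀ B ∈ blocks (L ^ 0) X, TayNormLE (P.gauge 0 B) r₀ (expWeight (G 0 B)) (expNegH H₀ B) a := by
      intro B hBm
      obtain ⟨x, -, rfl⟩ := mem_blocks.1 hBm
      have hH₀' : hamNorm (fieldWt h (L : ℝ) d 0) ((L : ℝ) ^ 0) (blockOf (L ^ 0) x).card H₀ ≤ 1 / 8 := by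
        rw [hcard x]; exact hH₀
      exact tayNormLE_expNegH_strong_abkm (R := R) (N := N) (Mord := Mord) hd hLodd hM (Nat.zero_le N) hh hMord hp
        (subset_thicken (P.rad 0) (blockOf (L ^ 0) x)) r₀ hH₀'
    have h1 := tayNormLE_bprod (L ^ 0) (P.gauge 0 X) (fun B => P.gauge 0 B) X hF hleb (fun B _ => hEd H₀ B)
      (fun B _ => isGaugeLocal_cexp_neg_eval h𝔥.ne' hR0.ne' hp (subset_thicken _ _) H₀) (fun _ _ => ha0)
    have hKeq : (fun φ : (Fin d → ZMod M) → ℝ => bprod (L ^ 0) (fun B => expNegH H₀ B φ) X) = expNegH H₀ X :=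
      funext fun φ => bprod_cexp_neg_eval H₀ hX' φ
    have hWeq : (fun φ : (Fin d → ZMod M) → ℝ => ∏ B ∈ blocks (L ^ 0) X, expWeight (G 0 B) φ) = expWeight (G 0 X) :=
      funext fun φ => prod_expWeight_blocks hGs 0 (L ^ 0) hX' φ
    rw [hKeq, hWeq, Finset.prod_const, card_blocks_eq_numBlocks, hmX] at h1
    exact h1
  have hlip : ∀ (H₁ H₂ : RelevantHamiltonian ℂ d),
      hamNorm (fieldWt h (L : ℝ) d 0) ((L : ℝ) ^ 0) (L ^ (d * 0)) H₁ ≤ 1 / 16 →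
      hamNorm (fieldWt h (L : ℝ) d 0) ((L : ℝ) ^ 0) (L ^ (d * 0)) H₂ ≤ 1 / 16 →
      TayNormLE (P.gauge 0 X) r₀ (expWeight (G 0 X)) (fun φ => expNegH H₁ X φ - expNegH H₂ X φ)
        ((a + 16 * Real.exp (3 / 8) * hamNorm (fieldWt h (L : ℝ) d 0) ((L : ℝ) ^ 0) (L ^ (d * 0)) (H₁ - H₂)) ^ m - a ^ m) := by
    intro H₁ H₂ hH₁ hH₂
    have hF' : ∀ B ∈ blocks (L ^ 0) X, TayNormLE (P.gauge 0 B) r₀ (expWeight (G 0 B)) (expNegH H₂ B) a := by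
      intro B hBm
      obtain ⟨x, -, rfl⟩ := mem_blocks.1 hBm
      have h2 : hamNorm (fieldWt h (L : ℝ) d 0) ((L : ℝ) ^ 0) (blockOf (L ^ 0) x).card H₂ ≤ 1 / 8 := by
        rw [hcard x]; exact hH₂.trans (by norm_num)
      exact tayNormLE_expNegH_strong_abkm (R := R) (N := N) (Mord := Mord) hd hLodd hM (Nat.zero_le N) hh hMord hp
        (subset_thicken (P.rad 0) (blockOf (L ^ 0) x)) r₀ h2
    have hΔ : ∀ B ∈ blocks (L ^ 0) X, TayNormLE (P.gauge 0 B) r₀ (expWeight (G 0 B))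
        (fun φ => expNegH H₁ B φ - expNegH H₂ B φ)
        (16 * Real.exp (3 / 8) * hamNorm (fieldWt h (L : ℝ) d 0) ((L : ℝ) ^ 0) (L ^ (d * 0)) (H₁ - H₂)) := by
      intro B hBm
      obtain ⟨x, -, rfl⟩ := mem_blocks.1 hBm
      have h1 : hamNorm (fieldWt h (L : ℝ) d 0) ((L : ℝ) ^ 0) (blockOf (L ^ 0) x).card H₁ ≤ 1 / 16 := by
        rw [hcard x]; exact hH₁
      have h2 : hamNorm (fieldWt h (L : ℝ) d 0) ((L : ℝ) ^ 0) (blockOf (L ^ 0) x).card H₂ ≤ 1 / 16 := by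
        rw [hcard x]; exact hH₂
      have h := tayNormLE_expNegH_sub_strong_abkm (R := R) (N := N) (Mord := Mord) hd hLodd hM (Nat.zero_le N) hh
        hMord hp (subset_thicken (P.rad 0) (blockOf (L ^ 0) x)) r₀ h1 h2
      rw [hcard x] at h
      exact h
    have h1 := tayNormLE_bprod_sub_bprod (L ^ 0) (P.gauge 0 X) (fun B => P.gauge 0 B) hX' hF' hΔ hleb
      (fun B _ => hEd H₁ B) (fun B _ => hEd H₂ B)
      (fun B _ => isGaugeLocal_cexp_neg_eval h𝔥.ne' hR0.ne' hp (subset_thicken _ _) H₁)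
      (fun B _ => isGaugeLocal_cexp_neg_eval h𝔥.ne' hR0.ne' hp (subset_thicken _ _) H₂)
      (fun _ _ => ha0) (fun _ _ => mul_nonneg (by positivity) (hamNorm_nonneg h𝔥.le hR0.le _ _))
    have hKeq : (fun φ : (Fin d → ZMod M) → ℝ => bprod (L ^ 0) (fun B => expNegH H₁ B φ) X -
        bprod (L ^ 0) (fun B => expNegH H₂ B φ) X) = fun φ => expNegH H₁ X φ - expNegH H₂ X φ := by
      funext φ
      have e1 : bprod (L ^ 0) (fun B => expNegH H₁ B φ) X = expNegH H₁ X φ := bprod_cexp_neg_eval H₁ hX' φ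
      have e2 : bprod (L ^ 0) (fun B => expNegH H₂ B φ) X = expNegH H₂ X φ := bprod_cexp_neg_eval H₂ hX' φ
      rw [e1, e2]
    have hWeq : (fun φ : (Fin d → ZMod M) → ℝ => ∏ B ∈ blocks (L ^ 0) X, expWeight (G 0 B) φ) = expWeight (G 0 X) :=
      funext fun φ => prod_expWeight_blocks hGs 0 (L ^ 0) hX' φ
    rw [hKeq, hWeq, Finset.prod_const, Finset.prod_const, card_blocks_eq_numBlocks, hmX] at h1
    exact h1
  have eY : H + Y - H = Y := by abel
  have eZ : H + Z - H = Z := by abel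
  -- the four pieces
  have hf00 := hval H (hH.trans (by norm_num))
  have hf10 : TayNormLE (P.gauge 0 X) r₀ (expWeight (G 0 X)) (fun φ => expNegH (H + Y) X φ - expNegH H X φ)
      ((a + α) ^ m - a ^ m) := by
    have h := hlip (H + Y) H hHY hH
    rw [eY] at h
    exact h
  have hf01 : TayNormLE (P.gauge 0 X) r₀ (expWeight (G 0 X)) (fun φ => expNegH (H + Z) X φ - expNegH H X φ)
      ((a + β) ^ m - a ^ m) := by
    have h := hlip (H + Z) H hHZ hH
    rw [eZ] at h
    exact h
  have hf2 : TayNormLE (P.gauge 0 X) r₀ (expWeight (G 0 X))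
      (fun φ => expNegH (H + Y + Z) X φ - expNegH (H + Y) X φ - expNegH (H + Z) X φ + expNegH H X φ)
      (((a + α + β) ^ m - (a + α) ^ m - ((a + β) ^ m - a ^ m)) + ((a + γ) ^ m - a ^ m)) := by
    have h := tayNormLE_expNegH_secondDiff_polymer_abkm (p := p) (r₀ := r₀) (A := A) hd hLodd hM (Nat.zero_le N) hp hMord
      hB hδ₀ hδ₁ hh hh0 hH hHY hHZ hHYZ hY hZ hX'
    rw [hmX] at h
    exact h
  -- the site products: value, first differences, second difference
  have h𝒦Ub := iteratedFDeriv_bound_add h𝒦 hU h𝒦b hUb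
  have h𝒦Vb := iteratedFDeriv_bound_add h𝒦 hV h𝒦b hVb
  have h𝒦UVb := iteratedFDeriv_bound_add (h𝒦.add hU) hV h𝒦Ub hVb
  have hXS : X ⊆ thicken (starRad R L d 0) X := subset_thicken _ _
  have hg11 : TayNormLE (P.gauge 0 X) r₀ (fun φ => Real.exp ((∑ x ∈ X, ∑ i, (gradAt x φ i) ^ 2) / 4))
      (initK (fun z => 𝒦 z + U z + V z) X) (((ρ + u + v) * e') ^ m) := fun φ =>
    tayNorm_initK_le ((h𝒦.add hU).add hV) h𝒦UVb h𝔥 hR0 hp1 hXS φ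
  have hgU : TayNormLE (P.gauge 0 X) r₀ (fun φ => Real.exp ((∑ x ∈ X, ∑ i, (gradAt x φ i) ^ 2) / 4))
      (fun φ => initK (fun z => 𝒦 z + U z + V z) X φ - initK (fun z => 𝒦 z + U z) X φ)
      (((ρ + u + v) * e') ^ m - ((ρ + u) * e') ^ m) := by
    have hΔb : ∀ k, k ≤ r₀ → ∀ z : Fin d → ℝ,
        ‖iteratedFDeriv ℝ k (fun z => (𝒦 z + U z + V z) - (𝒦 z + U z)) z‖ ≤ v * Real.exp ((∑ i, z i ^ 2) / 4) := by
      have e : (fun z => (𝒦 z + U z + V z) - (𝒦 z + U z)) = V := by funext z; ring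
      rw [e]; exact hVb
    have h := tayNormLE_initK_sub (M := M) ((h𝒦.add hU).add hV) (h𝒦.add hU) h𝒦Ub hΔb h𝔥 hR0 hp1 hXS
    have e : ρ + u + v = (ρ + u) + v := by ring
    rw [e]; exact h
  have hgV : TayNormLE (P.gauge 0 X) r₀ (fun φ => Real.exp ((∑ x ∈ X, ∑ i, (gradAt x φ i) ^ 2) / 4))
      (fun φ => initK (fun z => 𝒦 z + U z + V z) X φ - initK (fun z => 𝒦 z + V z) X φ)
      (((ρ + u + v) * e') ^ m - ((ρ + v) * e') ^ m) := by
    have hΔb : ∀ k, k ≤ r₀ → ∀ z : Fin d → ℝ,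
        ‖iteratedFDeriv ℝ k (fun z => (𝒦 z + U z + V z) - (𝒦 z + V z)) z‖ ≤ u * Real.exp ((∑ i, z i ^ 2) / 4) := by
      have e : (fun z => (𝒦 z + U z + V z) - (𝒦 z + V z)) = U := by funext z; ring
      rw [e]; exact hUb
    have h := tayNormLE_initK_sub (M := M) ((h𝒦.add hU).add hV) (h𝒦.add hV) h𝒦Vb hΔb h𝔥 hR0 hp1 hXS
    have e : ρ + u + v = (ρ + v) + u := by ring
    rw [e]; exact h
  have hg2 := tayNormLE_initK_secondDiff (M := M) h𝒦 hU hV h𝒦b hUb hVb h𝔥 hR0 hp1 hXS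
  -- regularity / locality
  have hId : ∀ (F : (Fin d → ℝ) → ℂ), ContDiff ℝ r₀ F → ContDiff ℝ r₀ (initK (M := M) F X) := fun F hF => contDiff_initK hF X
  have hIloc : ∀ (F : (Fin d → ℝ) → ℂ), IsGaugeLocal (P.gauge 0 X) (initK (M := M) F X) := fun F =>
    isGaugeLocal_initK F h𝔥 hR0 hp1 hXS
  have hw : ∀ φ, expWeight (G 0 X) φ * Real.exp ((∑ x ∈ X, ∑ i, (gradAt x φ i) ^ 2) / 4) ≤ W.weight 0 X φ := by
    intro φ
    rw [mul_comm]
    exact exp_quarter_mul_expWeight_le_weight_zero (strongCoef_le hδ₀ hδ₁ hh hh0 0) X φ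
  have hd𝒦UV := (h𝒦.add hU).add hV
  -- nonnegativity of the constants
  have hpowmono : ∀ {s t : ℝ}, 0 ≤ s → s ≤ t → s ^ m ≤ t ^ m := fun hs hst => pow_le_pow_left₀ hs hst _
  have c1 : 0 ≤ ((a + α + β) ^ m - (a + α) ^ m - ((a + β) ^ m - a ^ m)) + ((a + γ) ^ m - a ^ m) := by
    have h0 := hf2 0
    exact le_of_mul_le_mul_right (by rw [zero_mul]; exact (tayNorm_nonneg _ _ _ _).trans h0) (by unfold expWeight; exact Real.exp_pos _)
  have c2 : 0 ≤ (a + α) ^ m - a ^ m := sub_nonneg.2 (hpowmono ha0 (le_add_of_nonneg_right hα0))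
  have c3 : 0 ≤ (a + β) ^ m - a ^ m := sub_nonneg.2 (hpowmono ha0 (le_add_of_nonneg_right hβ0))
  have c4 : 0 ≤ a ^ m := pow_nonneg ha0 _
  have d1 : 0 ≤ ((ρ + u + v) * e') ^ m := pow_nonneg (mul_nonneg (by linarith) he'0) _
  have d2 : 0 ≤ ((ρ + u + v) * e') ^ m - ((ρ + u) * e') ^ m :=
    sub_nonneg.2 (hpowmono (mul_nonneg (by linarith) he'0) (mul_le_mul_of_nonneg_right (by linarith) he'0))
  have d3 : 0 ≤ ((ρ + u + v) * e') ^ m - ((ρ + v) * e') ^ m :=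
    sub_nonneg.2 (hpowmono (mul_nonneg (by linarith) he'0) (mul_le_mul_of_nonneg_right (by linarith) he'0))
  have d4 : 0 ≤ (((ρ + u + v) * e') ^ m - ((ρ + u) * e') ^ m) - (((ρ + v) * e') ^ m - (ρ * e') ^ m) := by
    have h0 := hg2 0
    exact le_of_mul_le_mul_right (by rw [zero_mul]; exact (tayNorm_nonneg _ _ _ _).trans h0) (Real.exp_pos _)
  -- the four products
  have t1 := TayNormLE.mul (T := P.gauge 0 X) (w := W.weight 0 X) hf2 hg11 (fun ξ => le_rfl) (fun ξ => le_rfl)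
    ((((hEd (H + Y + Z) X).sub (hEd (H + Y) X)).sub (hEd (H + Z) X)).add (hEd H X)) (hId _ hd𝒦UV)
    (IsGaugeLocal.op₂ _ (fun u v : ℂ => u + v)
      (IsGaugeLocal.op₂ _ (fun u v : ℂ => u - v)
        (IsGaugeLocal.op₂ _ (fun u v : ℂ => u - v) (hEloc (H + Y + Z) X (Finset.Subset.refl X)) (hEloc (H + Y) X (Finset.Subset.refl X)))
        (hEloc (H + Z) X (Finset.Subset.refl X)))
      (hEloc H X (Finset.Subset.refl X)))
    (hIloc _) c1 d1 hw
  have t2 := TayNormLE.mul (T := P.gauge 0 X) (w := W.weight 0 X) hf10 hgU (fun ξ => le_rfl) (fun ξ => le_rfl)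
    ((hEd (H + Y) X).sub (hEd H X)) ((hId _ hd𝒦UV).sub (hId _ (h𝒦.add hU)))
    (IsGaugeLocal.op₂ _ (fun u v : ℂ => u - v) (hEloc (H + Y) X (Finset.Subset.refl X)) (hEloc H X (Finset.Subset.refl X)))
    (IsGaugeLocal.op₂ _ (fun u v : ℂ => u - v) (hIloc _) (hIloc _)) c2 d2 hw
  have t3 := TayNormLE.mul (T := P.gauge 0 X) (w := W.weight 0 X) hf01 hgV (fun ξ => le_rfl) (fun ξ => le_rfl)
    ((hEd (H + Z) X).sub (hEd H X)) ((hId _ hd𝒦UV).sub (hId _ (h𝒦.add hV)))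
    (IsGaugeLocal.op₂ _ (fun u v : ℂ => u - v) (hEloc (H + Z) X (Finset.Subset.refl X)) (hEloc H X (Finset.Subset.refl X)))
    (IsGaugeLocal.op₂ _ (fun u v : ℂ => u - v) (hIloc _) (hIloc _)) c3 d3 hw
  have t4 := TayNormLE.mul (T := P.gauge 0 X) (w := W.weight 0 X) hf00 hg2 (fun ξ => le_rfl) (fun ξ => le_rfl)
    (hEd H X)
    ((((hId _ hd𝒦UV).sub (hId _ (h𝒦.add hU))).sub (hId _ (h𝒦.add hV))).add (hId _ h𝒦))
    (hEloc H X (Finset.Subset.refl X))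
    (IsGaugeLocal.op₂ _ (fun u v : ℂ => u + v)
      (IsGaugeLocal.op₂ _ (fun u v : ℂ => u - v)
        (IsGaugeLocal.op₂ _ (fun u v : ℂ => u - v) (hIloc _) (hIloc _)) (hIloc _)) (hIloc _)) c4 d4 hw
  have s12 := TayNormLE.add t1 t2
    (((((hEd (H + Y + Z) X).sub (hEd (H + Y) X)).sub (hEd (H + Z) X)).add (hEd H X)).mul (hId _ hd𝒦UV))
    (((hEd (H + Y) X).sub (hEd H X)).mul ((hId _ hd𝒦UV).sub (hId _ (h𝒦.add hU))))
  have s123 := TayNormLE.add s12 t3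
    ((((((hEd (H + Y + Z) X).sub (hEd (H + Y) X)).sub (hEd (H + Z) X)).add (hEd H X)).mul (hId _ hd𝒦UV)).add
      (((hEd (H + Y) X).sub (hEd H X)).mul ((hId _ hd𝒦UV).sub (hId _ (h𝒦.add hU)))))
    (((hEd (H + Z) X).sub (hEd H X)).mul ((hId _ hd𝒦UV).sub (hId _ (h𝒦.add hV))))
  have s1234 := TayNormLE.add s123 t4
    (((((((hEd (H + Y + Z) X).sub (hEd (H + Y) X)).sub (hEd (H + Z) X)).add (hEd H X)).mul (hId _ hd𝒦UV)).add
      (((hEd (H + Y) X).sub (hEd H X)).mul ((hId _ hd𝒦UV).sub (hId _ (h𝒦.add hU))))).add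
      (((hEd (H + Z) X).sub (hEd H X)).mul ((hId _ hd𝒦UV).sub (hId _ (h𝒦.add hV)))))
    ((hEd H X).mul ((((hId _ hd𝒦UV).sub (hId _ (h𝒦.add hU))).sub (hId _ (h𝒦.add hV))).add (hId _ h𝒦)))
  -- identify the function (discrete Leibniz rule)
  have hfun : ((fun φ => expNegH (H + Y + Z) X φ - expNegH (H + Y) X φ - expNegH (H + Z) X φ + expNegH H X φ)
        * initK (fun z => 𝒦 z + U z + V z) X
      + (fun φ => expNegH (H + Y) X φ - expNegH H X φ)
        * (fun φ => initK (fun z => 𝒦 z + U z + V z) X φ - initK (fun z => 𝒦 z + U z) X φ)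
      + (fun φ => expNegH (H + Z) X φ - expNegH H X φ)
        * (fun φ => initK (fun z => 𝒦 z + U z + V z) X φ - initK (fun z => 𝒦 z + V z) X φ)
      + expNegH H X * (fun φ => initK (fun z => 𝒦 z + U z + V z) X φ - initK (fun z => 𝒦 z + U z) X φ
          - initK (fun z => 𝒦 z + V z) X φ + initK 𝒦 X φ))
      = fun φ => initKH (fun z => 𝒦 z + U z + V z) (H + Y + Z) X φ - initKH (fun z => 𝒦 z + U z) (H + Y) X φ
        - initKH (fun z => 𝒦 z + V z) (H + Z) X φ + initKH (M := M) 𝒦 H X φ := by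
    funext φ
    simp only [Pi.add_apply, Pi.mul_apply, initKH_apply]
    ring
  rw [hfun] at s1234
  exact s1234

end Literature.MathematicalPhysics.StatisticalMechanics.GradientRG

end
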